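import Summits.AnomalousDissipation.AnomalousDissipation.Theorems.KolmogorovFloor.Negative.ThreeModesBase
import Summits.AnomalousDissipation.AnomalousDissipation.Theorems.FloorCertificate.Negative.WeakDuality
import Literature.Analysis.FluidPDE.NSUniqueness2DParts
import Literature.Analysis.FluidPDE.NavierStokesConcentrationTools

/-!
# Tools for the floor at a CHEAP BASE STATE (negative side of `KolmogorovFloor`, stmt-14030)

cdisprove seat `refuter-cdisprove-stmt-AnomalousDissipation-14030-0` (2026-08-16). A *cheap base* is a smooth
solenoidal mean-zero field `a` whose steady-Euler defect `(a·∇)a − f` is small against band-limited multipliers: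
smooth quiet Euler points (`P[(a·∇)a] = f`, defect `0`; crux `SmoothEulerCoerciveForce`), the dressed laminar
rays of `Cruxes/KolmogorovFloor/DRESSED-RAY-r1-3.md`, the `CHEAP(f)` states of the round-2 card
`cheap-steady-euler-closure`. This file supplies the kinematics of the kill at such a base
(`Negative/CheapBaseKill.lean`):

* `integral_inner_laplacian_le_slope` — the DRIFT `(a, ΔW) ≤ 4π² · (Σ_k |k|‖â(k)‖) · max_k |k|‖Ŵ(k)‖` for a
  band-limited `W` (finite Parseval, `𝓕(ΔW) = −4π²|k|²Ŵ`);
* `floor_on_rep` — the FLOOR instance at a state of `H` written on its smooth representative;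
* `inertial_pair_sum`, `integral_inner_pair_sum` — the `±w` symmetrisation: summing the floor at `a + w` and
  `a − w` kills every term linear in `w` (no frequency separation between base and waves is needed);
* `norm_sq_add_le_two`, `integral_norm_sq_add_le` — the Leray-ball bookkeeping `∫‖a ± w‖² ≤ 2∫‖a‖² + 2∫‖w‖²`;
* `coords_add_modes_eq` — unresolved waves are invisible to the cylindrical coordinates at ANY base.
-/

noncomputable section

open MeasureTheory UnitAddTorus Matrix
open scoped InnerProductSpace ENNReal ComplexConjugate

namespace Summit.AnomalousDissipation.AnomalousDissipation.Theorems.KolmogorovFloor.Negative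

open Literature.Analysis.FunctionSpaces Literature.Analysis.FluidPDE
open Summit.AnomalousDissipation.AnomalousDissipation.Theorems.TaylorCertificatePair.Negative

local notation "𝕋" => UnitAddTorus (Fin 3)
local notation "E³" => EuclideanSpace ℝ (Fin 3)
local notation "L2T" => Lp (EuclideanSpace ℝ (Fin 3)) 2 (volume : Measure (UnitAddTorus (Fin 3)))

/-! ### The drift against a band-limited multiplier -/

/-- **Drift bound.** For smooth `a` and a band-limited smooth `W` with slope `|k|‖Ŵ(k)‖ ≤ M`:
`(a, ΔW) ≤ 4π² · (Σ_{|k| ≤ N} |k|‖â(k)‖) · M`. -/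
theorem integral_inner_laplacian_le_slope {a W : 𝕋 → E³} (ha : Torus.IsSmooth a) (hW : Torus.IsSmooth W) {N : ℕ}
    (hband : ∀ κ, (N : ℝ) ^ 2 < Torus.freqNormSq κ → mFourierCoeff (EuclideanSpace.complexify ∘ W) κ = 0)
    {M Sa : ℝ} (hM0 : 0 ≤ M)
    (hM : ∀ κ, Real.sqrt (Torus.freqNormSq κ) * ‖mFourierCoeff (EuclideanSpace.complexify ∘ W) κ‖ ≤ M)
    (hSa : ∑ κ ∈ Torus.freqBall N, Real.sqrt (Torus.freqNormSq κ) * ‖mFourierCoeff (EuclideanSpace.complexify ∘ a) κ‖ ≤ Sa) :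
    ∫ x, ⟪a x, Torus.laplacian W x⟫_ℝ ≤ 4 * Real.pi ^ 2 * Sa * M := by
  have hbandL : ∀ κ, (N : ℝ) ^ 2 < Torus.freqNormSq κ →
      mFourierCoeff (EuclideanSpace.complexify ∘ Torus.laplacian W) κ = 0 := by
    intro κ hκ
    rw [Torus.mFourierCoeff_complexify_laplacian hW, hband κ hκ, smul_zero, neg_zero]
  rw [Torus.integral_inner_eq_sum_freqBall (ha.memLp 2) (hW.laplacian.memLp 2) hbandL]
  have hterm : ∀ κ ∈ Torus.freqBall N,
      (⟪mFourierCoeff (EuclideanSpace.complexify ∘ a) κ,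
          mFourierCoeff (EuclideanSpace.complexify ∘ Torus.laplacian W) κ⟫_ℂ).re ≤
        4 * Real.pi ^ 2 * M * (Real.sqrt (Torus.freqNormSq κ) * ‖mFourierCoeff (EuclideanSpace.complexify ∘ a) κ‖) := by
    intro κ _
    rw [Torus.mFourierCoeff_complexify_laplacian hW]
    refine (re_inner_le_norm_mul _ _).trans ?_
    rw [norm_neg, norm_smul, Complex.norm_real,
      Real.norm_of_nonneg (by have := Torus.freqNormSq_nonneg κ; positivity)]
    set s : ℝ := Real.sqrt (Torus.freqNormSq κ) with hsdef
    have hs2 : Torus.freqNormSq κ = s * s := by rw [hsdef, Real.mul_self_sqrt (Torus.freqNormSq_nonneg κ)]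
    have h1 : s * ‖mFourierCoeff (EuclideanSpace.complexify ∘ W) κ‖ ≤ M := hM κ
    have h0 : 0 ≤ s * ‖mFourierCoeff (EuclideanSpace.complexify ∘ a) κ‖ := by positivity
    rw [hs2]
    calc ‖mFourierCoeff (EuclideanSpace.complexify ∘ a) κ‖ *
          (4 * Real.pi ^ 2 * (s * s) * ‖mFourierCoeff (EuclideanSpace.complexify ∘ W) κ‖)
        = 4 * Real.pi ^ 2 * (s * ‖mFourierCoeff (EuclideanSpace.complexify ∘ a) κ‖) *
            (s * ‖mFourierCoeff (EuclideanSpace.complexify ∘ W) κ‖) := by ring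
      _ ≤ 4 * Real.pi ^ 2 * (s * ‖mFourierCoeff (EuclideanSpace.complexify ∘ a) κ‖) * M :=
          mul_le_mul_of_nonneg_left h1 (by positivity)
      _ = 4 * Real.pi ^ 2 * M * (s * ‖mFourierCoeff (EuclideanSpace.complexify ∘ a) κ‖) := by ring
  calc ∑ κ ∈ Torus.freqBall N, (⟪mFourierCoeff (EuclideanSpace.complexify ∘ a) κ,
          mFourierCoeff (EuclideanSpace.complexify ∘ Torus.laplacian W) κ⟫_ℂ).re
      ≤ ∑ κ ∈ Torus.freqBall N, 4 * Real.pi ^ 2 * M *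
          (Real.sqrt (Torus.freqNormSq κ) * ‖mFourierCoeff (EuclideanSpace.complexify ∘ a) κ‖) :=
        Finset.sum_le_sum hterm
    _ = 4 * Real.pi ^ 2 * M * ∑ κ ∈ Torus.freqBall N,
          Real.sqrt (Torus.freqNormSq κ) * ‖mFourierCoeff (EuclideanSpace.complexify ∘ a) κ‖ := by
        rw [Finset.mul_sum]
    _ ≤ 4 * Real.pi ^ 2 * M * Sa := mul_le_mul_of_nonneg_left hSa (by positivity)
    _ = 4 * Real.pi ^ 2 * Sa * M := by ring

/-- For smooth `a`, the partial slope sums are bounded by the slope series, which converges: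
`Σ_{|k|≤N} |k|‖â(k)‖ ≤ Σ_k (‖â(k)‖ + ‖(Δa)^(k)‖)` (`|k| ≤ 1 + 4π²|k|²`). -/
theorem slope_sum_le_tsum {a : 𝕋 → E³} (ha : Torus.IsSmooth a) (N : ℕ) :
    ∑ κ ∈ Torus.freqBall N, Real.sqrt (Torus.freqNormSq κ) * ‖mFourierCoeff (EuclideanSpace.complexify ∘ a) κ‖ ≤
      (∑' κ, ‖mFourierCoeff (EuclideanSpace.complexify ∘ a) κ‖) +
        ∑' κ, ‖mFourierCoeff (EuclideanSpace.complexify ∘ Torus.laplacian a) κ‖ := by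
  have hs1 := Torus.summable_norm_mFourierCoeff_of_isSmooth ha
  have hs2 := Torus.summable_norm_mFourierCoeff_of_isSmooth ha.laplacian
  have hpt : ∀ κ, Real.sqrt (Torus.freqNormSq κ) * ‖mFourierCoeff (EuclideanSpace.complexify ∘ a) κ‖ ≤
      ‖mFourierCoeff (EuclideanSpace.complexify ∘ a) κ‖ +
        ‖mFourierCoeff (EuclideanSpace.complexify ∘ Torus.laplacian a) κ‖ := by
    intro κ
    rw [Torus.mFourierCoeff_complexify_laplacian ha, norm_neg, norm_smul, Complex.norm_real,
      Real.norm_of_nonneg (by have := Torus.freqNormSq_nonneg κ; positivity)]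
    have hq := Torus.freqNormSq_nonneg κ
    have hn := norm_nonneg (mFourierCoeff (EuclideanSpace.complexify ∘ a) κ)
    -- `√t ≤ 1 + 4π² t` for `t ≥ 0`
    have hsq : Real.sqrt (Torus.freqNormSq κ) ≤ 1 + 4 * Real.pi ^ 2 * Torus.freqNormSq κ := by
      have h1 : Real.sqrt (Torus.freqNormSq κ) ≤ 1 + Torus.freqNormSq κ := by
        rw [Real.sqrt_le_left (by positivity)]
        nlinarith only [hq]
      have hpi : (1 : ℝ) ≤ 4 * Real.pi ^ 2 := by
        have := Real.pi_gt_three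
        nlinarith only [this]
      have h2 : Torus.freqNormSq κ ≤ 4 * Real.pi ^ 2 * Torus.freqNormSq κ := by
        have := mul_le_mul_of_nonneg_right hpi hq
        linarith only [this]
      linarith only [h1, h2]
    have := mul_le_mul_of_nonneg_right hsq hn
    linarith only [this]
  calc ∑ κ ∈ Torus.freqBall N, Real.sqrt (Torus.freqNormSq κ) * ‖mFourierCoeff (EuclideanSpace.complexify ∘ a) κ‖
      ≤ ∑ κ ∈ Torus.freqBall N, (‖mFourierCoeff (EuclideanSpace.complexify ∘ a) κ‖ +
          ‖mFourierCoeff (EuclideanSpace.complexify ∘ Torus.laplacian a) κ‖) := Finset.sum_le_sum fun κ _ => hpt κ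
    _ = (∑ κ ∈ Torus.freqBall N, ‖mFourierCoeff (EuclideanSpace.complexify ∘ a) κ‖) +
          ∑ κ ∈ Torus.freqBall N, ‖mFourierCoeff (EuclideanSpace.complexify ∘ Torus.laplacian a) κ‖ :=
        Finset.sum_add_distrib
    _ ≤ _ := add_le_add (hs1.sum_le_tsum _ fun κ _ => norm_nonneg _) (hs2.sum_le_tsum _ fun κ _ => norm_nonneg _)

/-! ### The floor instance on a representative -/

/-- **The FLOOR at a state of `H`, written on its smooth representative `v`** (with the multiplier `W`). -/
theorem floor_on_rep {ν θ ε₀ F2 : ℝ} {f v W : 𝕋 → E³} (hv : Torus.IsSmooth v)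
    {Φ : Torus.CylindricalTest (Fin 3)} {u : Torus.energySpace (Fin 3)}
    (hu : ((u : L2T) : 𝕋 → E³) =ᵐ[volume] v) (hW : Φ.grad u = W) (hball : ∫ x, ‖v x‖ ^ 2 ≤ F2)
    (hfl : Torus.eGradNormSq ((u : L2T) : 𝕋 → E³) ≠ ⊤ → ‖u‖ ^ 2 ≤ F2 →
      ε₀ ≤ ν * (Torus.eGradNormSq ((u : L2T) : 𝕋 → E³)).toReal + Torus.nsGeneratorPairing ν f u (Φ.grad u) +
        2 * θ * (Torus.pairing (u : L2T) f - ν * (Torus.eGradNormSq ((u : L2T) : 𝕋 → E³)).toReal)) :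
    ε₀ ≤ ν * (Torus.eGradNormSq v).toReal +
      ((∫ x, ⟪f x, W x⟫_ℝ) + ν * (∫ x, ⟪v x, Torus.laplacian W x⟫_ℝ) + ∫ x, ⟪Torus.fderiv W x (v x), v x⟫_ℝ) +
        2 * θ * ((∫ x, ⟪v x, f x⟫_ℝ) - ν * (Torus.eGradNormSq v).toReal) := by
  have hfin : Torus.eGradNormSq ((u : L2T) : 𝕋 → E³) ≠ ⊤ := by
    rw [eGradNormSq_congr_ae' hu]
    exact Summit.AnomalousDissipation.AnomalousDissipation.Theorems.FloorCertificate.Negative.eGradNormSq_ne_top_of_smooth hv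
  have hnorm : ‖u‖ ^ 2 ≤ F2 := by rw [norm_sq_of_ae hu]; exact hball
  have h := hfl hfin hnorm
  rw [hW, nsGeneratorPairing_of_ae hu, pairing_of_ae hu, eGradNormSq_congr_ae' hu] at h
  exact h

/-! ### The `± w` symmetrisation -/

/-- Pointwise: `⟪L(a+w), a+w⟫ + ⟪L(a−w), a−w⟫ = 2⟪La, a⟫ + 2⟪Lw, w⟫` for a linear map `L`. -/
theorem inner_map_pair_sum (L : E³ →L[ℝ] E³) (a w : E³) :
    ⟪L (a + w), a + w⟫_ℝ + ⟪L (a - w), a - w⟫_ℝ = 2 * ⟪L a, a⟫_ℝ + 2 * ⟪L w, w⟫_ℝ := by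
  simp only [map_add, map_sub, inner_add_left, inner_add_right, inner_sub_left, inner_sub_right]
  ring

/-- **Inertial `±` symmetrisation.** For smooth `a, w, W`:
`I(a + w, W) + I(a − w, W) = 2 I(a, W) + 2 I(w, W)` where `I(u, W) = ∫⟪∇W · u, u⟫`. -/
theorem inertial_pair_sum {a w W : 𝕋 → E³} (ha : Torus.IsSmooth a) (hw : Torus.IsSmooth w) (hW : Torus.IsSmooth W) :
    (∫ x, ⟪Torus.fderiv W x ((a + w) x), (a + w) x⟫_ℝ) + ∫ x, ⟪Torus.fderiv W x ((a - w) x), (a - w) x⟫_ℝ =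
      2 * (∫ x, ⟪Torus.fderiv W x (a x), a x⟫_ℝ) + 2 * ∫ x, ⟪Torus.fderiv W x (w x), w x⟫_ℝ := by
  have hi : ∀ {u : 𝕋 → E³}, Torus.IsSmooth u → Integrable (fun x => ⟪Torus.fderiv W x (u x), u x⟫_ℝ) volume := by
    intro u hu
    have := ((hu.convect hW).inner hu).integrable
    exact this
  rw [← integral_add (hi (ha.add hw)) (hi (ha.sub hw)), ← integral_const_mul, ← integral_const_mul,
    ← integral_add ((hi ha).const_mul 2) ((hi hw).const_mul 2)]
  refine integral_congr_ae (ae_of_all _ fun x => ?_)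
  simp only [Pi.add_apply, Pi.sub_apply]
  exact inner_map_pair_sum (Torus.fderiv W x) (a x) (w x)

/-- **Linear `±` symmetrisation**: `∫⟪a + w, g⟫ + ∫⟪a − w, g⟫ = 2∫⟪a, g⟫` for integrable data. -/
theorem integral_inner_pair_sum {a w g : 𝕋 → E³} (ha : Torus.IsSmooth a) (hw : Torus.IsSmooth w) (hg : Torus.IsSmooth g) :
    (∫ x, ⟪(a + w) x, g x⟫_ℝ) + ∫ x, ⟪(a - w) x, g x⟫_ℝ = 2 * ∫ x, ⟪a x, g x⟫_ℝ := by
  rw [← integral_add ((ha.add hw).inner hg).integrable ((ha.sub hw).inner hg).integrable, ← integral_const_mul]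
  refine integral_congr_ae (ae_of_all _ fun x => ?_)
  simp only [Pi.add_apply, Pi.sub_apply, inner_add_left, inner_sub_left]
  ring

/-! ### Leray-ball bookkeeping -/

/-- `‖x + y‖² ≤ 2‖x‖² + 2‖y‖²`. -/
theorem norm_sq_add_le_two (x y : E³) : ‖x + y‖ ^ 2 ≤ 2 * ‖x‖ ^ 2 + 2 * ‖y‖ ^ 2 := by
  have h := norm_add_le x y
  have h2 : ‖x + y‖ ^ 2 ≤ (‖x‖ + ‖y‖) ^ 2 := pow_le_pow_left₀ (norm_nonneg _) h 2
  nlinarith only [h2, sq_nonneg (‖x‖ - ‖y‖)]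

/-- `∫‖a + w‖² ≤ 2∫‖a‖² + 2∫‖w‖²` for continuous fields on the torus. -/
theorem integral_norm_sq_add_le {a w : 𝕋 → E³} (ha : Torus.IsSmooth a) (hw : Torus.IsSmooth w) :
    ∫ x, ‖(a + w) x‖ ^ 2 ≤ 2 * (∫ x, ‖a x‖ ^ 2) + 2 * ∫ x, ‖w x‖ ^ 2 := by
  have hia : Integrable (fun x => ‖a x‖ ^ 2) volume := (ha.memLp 2).integrable_norm_pow two_ne_zero
  have hiw : Integrable (fun x => ‖w x‖ ^ 2) volume := (hw.memLp 2).integrable_norm_pow two_ne_zero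
  have hiaw : Integrable (fun x => ‖(a + w) x‖ ^ 2) volume := ((ha.add hw).memLp 2).integrable_norm_pow two_ne_zero
  have h : ∫ x, ‖(a + w) x‖ ^ 2 ≤ ∫ x, (2 * ‖a x‖ ^ 2 + 2 * ‖w x‖ ^ 2) :=
    integral_mono hiaw ((hia.const_mul 2).add (hiw.const_mul 2)) fun x => norm_sq_add_le_two (a x) (w x)
  rw [integral_add (hia.const_mul 2) (hiw.const_mul 2), integral_const_mul, integral_const_mul] at h
  exact h

/-! ### Unresolved waves are invisible to the coordinates, at any base -/

/-- The cylindrical coordinates of the state of `a + w` equal those of the state of `a` when `w` is a mode sum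
with all frequencies outside the ball of the (band-limited) test fields. -/
theorem coords_add_modes_eq (Φ : Torus.CylindricalTest (Fin 3)) {N : ℕ}
    (hΦ : ∀ i, Torus.fourierTruncate N (Φ.g i) = Φ.g i) {n : ℕ} {k : Fin n → (Fin 3 → ℤ)}
    {z : Fin n → EuclideanSpace ℂ (Fin 3)} (hk : ∀ m, (N : ℝ) ^ 2 < Torus.freqNormSq (k m))
    {a : 𝕋 → E³} (ha : Torus.IsSmooth a) {ua uw : Torus.energySpace (Fin 3)}
    (hua : ((ua : L2T) : 𝕋 → E³) =ᵐ[volume] a)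
    (huw : ((uw : L2T) : 𝕋 → E³) =ᵐ[volume] (a + ∑ mm, Torus.realTrigPoly {k mm} (fun _ => z mm))) :
    Φ.coords uw = Φ.coords ua := by
  ext i
  rw [coords_of_ae huw, coords_of_ae hua]
  have hgi : Torus.IsSmooth (Φ.g i) := Φ.g_smooth i
  have e : (fun x => ⟪(a + ∑ mm, Torus.realTrigPoly {k mm} (fun _ => z mm)) x, Φ.g i x⟫_ℝ) =
      fun x => ⟪a x, Φ.g i x⟫_ℝ + ⟪(∑ mm, Torus.realTrigPoly {k mm} (fun _ => z mm)) x, Φ.g i x⟫_ℝ := by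
    funext x; rw [Pi.add_apply, inner_add_left]
  rw [e, integral_add (ha.inner hgi).integrable ((isSmooth_modes k z).inner hgi).integrable,
    integral_inner_modes_left hgi.integrable]
  have h0 : ∀ m, (mFourierCoeff (EuclideanSpace.complexify ∘ (Φ.g i)) (k m)) = 0 := fun m =>
    fc_g_eq_zero Φ hΦ i (k m) (hk m)
  simp only [h0, inner_zero_right, Complex.zero_re, Finset.sum_const_zero, add_zero]

end Summit.AnomalousDissipation.AnomalousDissipation.Theorems.KolmogorovFloor.Negative
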